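import Summits.BirchSwinnertonDyer.BirchSwinnertonDyer.Theorems.KatoDescentTamePotSupersingularTameUpperFukudaQPRecords02
import Summits.BirchSwinnertonDyer.BirchSwinnertonDyer.Theorems.KatoDescentTamePotSupersingularTameUpperFukudaQPRecords05
import Literature.NumberTheory.IwasawaTheory.Fukuda1994Thm1RankProofs
import HarnessLib

/-!
# K8-t′ U₀ records on the three KT `3Nn` RANK-STABLE rows at `p = 3`, Fukuda's Theorem 1 (2) DISCHARGED

Written by the prover seat `bsd-potss-k8t-c4` g20 (cell `bsd-potss`; `--supports stmt-BirchSwinnertonDyer-19982 --as helper`;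
closes nothing; BSD claimed for no curve). The records `conjA_g<label>_3_fukuda` ((A) at `(W,3)`) and
`missingUpperBoundAt_g<label>_3_fukuda` (U₀) of the three FUKUDA2(K):RANK-STABLE rows 198927v1, 486720db1, 486720dc1 of kit j313536
(`…TameUpperFukudaQPRecords02/05`: displayed `hrk : rank₃ Cl(ℚ(P)₁) = rank₃ Cl(ℚ(P)) = 1`, class numbers `e: 1 → 2`) took Fukuda's
Theorem 1 (2) as the named-fact hypothesis `hF2 : fukuda1994_thm1_classGroupPRank_const_of_succ_eq`; it is now the tree theorem
`Literature.NumberTheory.IwasawaTheory.fukuda1994_thm1_classGroupPRank_const_of_succ_eq_holds` (`Fukuda1994Thm1RankProofs.lean`, proved at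
finite level, its rider `μ = 0` WITHOUT Iwasawa's structure theory), so each record is re-issued here WITHOUT `hF2` (suffix `F2`, one
application). Displayed named facts that REMAIN: `hCS` (Coates–Sujatha Thm. 3.4), `hI` (Iwasawa 1959 growth), `hFW` (Ferrero–Washington) for
(A); additionally `hKatoA`, `hGZK`, `hmod` for U₀; plus Cremona's `r_an = 0` (`hr`), a complex conjugation `c`, and the kit-certified layer datum
`hrk` (under GRH for the degree-24 layer, as recorded in the source files).
-/

set_option autoImplicit false
set_option linter.dupNamespace false

noncomputable section

open scoped Classical NumberField
open Polynomial WeierstrassCurve NumberField Field IntermediateField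
  Literature.NumberTheory.EllipticCurves Literature.NumberTheory.EllipticCurves.Rank1Residual
  Literature.NumberTheory.EllipticCurves.Rank1Residual.Typed
  Literature.NumberTheory.EllipticCurves.Rank1Residual.X11RankOneCertificates
  Literature.NumberTheory.GaloisRepresentations Literature.NumberTheory.SerreUniformity Literature.NumberTheory.IwasawaTheory
  Summit.BirchSwinnertonDyer.BirchSwinnertonDyer.Rank1Residual.IntModel
  Summit.BirchSwinnertonDyer.Rank1Residual Summit.BirchSwinnertonDyer.Rank1Residual.Additive
  Summit.BirchSwinnertonDyer.Rank1Residual.X11b Summit.BirchSwinnertonDyer.Rank1Residual.Supersingular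
  Summit.BirchSwinnertonDyer.BirchSwinnertonDyer.Theorems

namespace Summit.BirchSwinnertonDyer.BirchSwinnertonDyer.Theorems.TameUpperUnitTwistRecords

/-- **RECORD — statement (A) at `(E, 3)` for `E = 198927v1`** by Fukuda Thm. 1 (2) (`3`-ranks) on `K = ℚ(P)` at layers `(0, 1)`: door
`CartanMuRoadFukudaDoorsTprime.conjA_three_of_hasModPImageEqNonsplitCartanNormalizer_of_realRankSuccEqAt'` (`hram`-free). KERNEL: `E[3]`
irreducible (`irr_g198927v1_3`), image `= C_ns⁺(3)` (`hasModPImageEqNonsplitCartanNormalizer_g198927v1_3`). DISPLAYED: `hCS hI hFW hF2`; `c`; `hrk`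
(`rank₃ Cl(K₁) = rank₃ Cl(K) = 1`, kit j313536). CONDITIONAL; (A) asserted for
no curve. [cite: Fukuda1994, Thm. 1 (2), p. 264] [cite: CoatesSujatha2005, Thm. 3.4 (§3)] [cite: Serre1972, §2.4 Prop. 15, §5.2 (iv)]
[cite: Cremona2006, Table 1 (Cremona label 198927v1)]
hF2-FREE re-issue of `conjA_g198927v1_3_fukuda` (Fukuda 1994 Thm. 1 (2) is the tree theorem
`fukuda1994_thm1_classGroupPRank_const_of_succ_eq_holds`). -/
theorem conjA_g198927v1_3_fukudaF2
    (hCS : CoatesSujatha2005.thm34_fineSelmerDual_moduleFinite_of_classicalMuVanishes_divisionField)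
    (hI : iwasawa1959_classNumberPExp_growth) (hFW : ferreroWashington1979_classicalMuVanishes)
    {W : WeierstrassCurve ℚ} [W.IsElliptic] (hWeq : W = (⟨1, (-1), 0, (-5982405), 4132145294⟩ : WeierstrassCurve ℚ))
    {c : absoluteGaloisGroup ℚ} (hc : IsComplexConjugation (Rat.castHom ℝ) c)
    (hrk : ∀ κE : ZpExtension ↥(fixedField (Subgroup.zpowers (absRestrictNormalHom (W.divisionField 3) c))) 3,
      κE.IsCyclotomic → classGroupPRank κE (0 + 1) = classGroupPRank κE 0)
    (κ : ZpExtension ℚ 3) (hκ : κ.IsCyclotomic) :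
    ∃ (γ : absoluteGaloisGroup ℚ) (Df : W.FineSelmerDualData κ γ),
      Module.Finite ℤ_[3] (RestrictScalars ℤ_[3] (IwasawaAlgebra 3) Df.X) := by
  apply conjA_g198927v1_3_fukuda <;>
    first
    | exact Literature.NumberTheory.IwasawaTheory.fukuda1994_thm1_classGroupPRank_const_of_succ_eq_holds
    | assumption

/-- **RECORD — UPPER half `ord₃ #Ш(E) ≤ ord₃ #Ш(E)_an` for `E = 198927v1` at `p = 3`** (U₀-ns row of node 19202 / item 19982) by Fukuda Thm. 1 (2) (`3`-ranks) on
`K = ℚ(P)` at layers `(0, 1)`: door `CartanMuRoadFukudaDoorsTprime.missingUpperBoundAt_three_tame_of_hasModPImageEqNonsplitCartanNormalizer_of_realRankSuccEqAt'`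
(`hram`-free). KERNEL: `irr_g198927v1_3`, `addv_g198927v1_3`, `subTprime_g198927v1_3` (reused), `hasModPImageEqNonsplitCartanNormalizer_g198927v1_3`. DISPLAYED:
`hKatoA hGZK hmod hCS hI hFW hF2`; Cremona's `r_an = 0` (`hr`); `c`; `hrk` (`rank₃ Cl(K₁) = rank₃ Cl(K) = 1`, kit j313536). A SECOND road beside `missingUpperBoundAt_g198927v1_3`. Per row; nothing booked; BSD is
not proved by this. [cite: Kato2004Asterisque, Thm. 14.5 (3) (p. 236), Thm. 12.5 (3) (p. 222)] [cite: Fukuda1994, Thm. 1 (2), p. 264]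
[cite: CoatesSujatha2005, Thm. 3.4 (§3)] [cite: Serre1972, §2.4 Prop. 15, §5.2 (iv)] [cite: Cremona2006, Table 1 (Cremona label 198927v1)]
hF2-FREE re-issue of `missingUpperBoundAt_g198927v1_3_fukuda` (Fukuda 1994 Thm. 1 (2) is the tree theorem
`fukuda1994_thm1_classGroupPRank_const_of_succ_eq_holds`). -/
theorem missingUpperBoundAt_g198927v1_3_fukudaF2
    (hKatoA : Kato2004.rankZero_padicValNat_sha_add_padicValNat_tamagawa_le_of_additive_potGood_of_irreducible_of_fineSelmerDual_fg)
    (hGZK : rank_eq_analyticRank_of_analyticRank_le_one) (hmod : hasEntireLFunction_rat)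
    (hCS : CoatesSujatha2005.thm34_fineSelmerDual_moduleFinite_of_classicalMuVanishes_divisionField)
    (hI : iwasawa1959_classNumberPExp_growth) (hFW : ferreroWashington1979_classicalMuVanishes)
    {W : WeierstrassCurve ℚ} [W.IsElliptic] [W.IsGloballyMinimal] (hWeq : W = (⟨1, (-1), 0, (-5982405), 4132145294⟩ : WeierstrassCurve ℚ))
    (hr : W.analyticRank = 0) {c : absoluteGaloisGroup ℚ} (hc : IsComplexConjugation (Rat.castHom ℝ) c)
    (hrk : ∀ κE : ZpExtension ↥(fixedField (Subgroup.zpowers (absRestrictNormalHom (W.divisionField 3) c))) 3,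
      κE.IsCyclotomic → classGroupPRank κE (0 + 1) = classGroupPRank κE 0) :
    MissingUpperBoundAt W 3 := by
  apply missingUpperBoundAt_g198927v1_3_fukuda <;>
    first
    | exact Literature.NumberTheory.IwasawaTheory.fukuda1994_thm1_classGroupPRank_const_of_succ_eq_holds
    | assumption

/-- **RECORD — statement (A) at `(E, 3)` for `E = 486720db1`** by Fukuda Thm. 1 (2) (`3`-ranks) on `K = ℚ(P)` at layers `(0, 1)`: door
`CartanMuRoadFukudaDoorsTprime.conjA_three_of_hasModPImageEqNonsplitCartanNormalizer_of_realRankSuccEqAt'` (`hram`-free). KERNEL: `E[3]`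
irreducible (`irr_g486720db1_3`), image `= C_ns⁺(3)` (`hasModPImageEqNonsplitCartanNormalizer_g486720db1_3`). DISPLAYED: `hCS hI hFW hF2`; `c`; `hrk`
(`rank₃ Cl(K₁) = rank₃ Cl(K) = 1`, kit j313536). CONDITIONAL; (A) asserted for
no curve. [cite: Fukuda1994, Thm. 1 (2), p. 264] [cite: CoatesSujatha2005, Thm. 3.4 (§3)] [cite: Serre1972, §2.4 Prop. 15, §5.2 (iv)]
[cite: Cremona2006, Table 1 (Cremona label 486720db1)]
hF2-FREE re-issue of `conjA_g486720db1_3_fukuda` (Fukuda 1994 Thm. 1 (2) is the tree theorem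
`fukuda1994_thm1_classGroupPRank_const_of_succ_eq_holds`). -/
theorem conjA_g486720db1_3_fukudaF2
    (hCS : CoatesSujatha2005.thm34_fineSelmerDual_moduleFinite_of_classicalMuVanishes_divisionField)
    (hI : iwasawa1959_classNumberPExp_growth) (hFW : ferreroWashington1979_classicalMuVanishes)
    {W : WeierstrassCurve ℚ} [W.IsElliptic] (hWeq : W = (⟨0, 0, 0, 5813262, (-5593900338)⟩ : WeierstrassCurve ℚ))
    {c : absoluteGaloisGroup ℚ} (hc : IsComplexConjugation (Rat.castHom ℝ) c)
    (hrk : ∀ κE : ZpExtension ↥(fixedField (Subgroup.zpowers (absRestrictNormalHom (W.divisionField 3) c))) 3,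
      κE.IsCyclotomic → classGroupPRank κE (0 + 1) = classGroupPRank κE 0)
    (κ : ZpExtension ℚ 3) (hκ : κ.IsCyclotomic) :
    ∃ (γ : absoluteGaloisGroup ℚ) (Df : W.FineSelmerDualData κ γ),
      Module.Finite ℤ_[3] (RestrictScalars ℤ_[3] (IwasawaAlgebra 3) Df.X) := by
  apply conjA_g486720db1_3_fukuda <;>
    first
    | exact Literature.NumberTheory.IwasawaTheory.fukuda1994_thm1_classGroupPRank_const_of_succ_eq_holds
    | assumption

/-- **RECORD — UPPER half `ord₃ #Ш(E) ≤ ord₃ #Ш(E)_an` for `E = 486720db1` at `p = 3`** (U₀-ns row of node 19202 / item 19982) by Fukuda Thm. 1 (2) (`3`-ranks) on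
`K = ℚ(P)` at layers `(0, 1)`: door `CartanMuRoadFukudaDoorsTprime.missingUpperBoundAt_three_tame_of_hasModPImageEqNonsplitCartanNormalizer_of_realRankSuccEqAt'`
(`hram`-free). KERNEL: `irr_g486720db1_3`, `addv_g486720db1_3`, `subTprime_g486720db1_3` (reused), `hasModPImageEqNonsplitCartanNormalizer_g486720db1_3`. DISPLAYED:
`hKatoA hGZK hmod hCS hI hFW hF2`; Cremona's `r_an = 0` (`hr`); `c`; `hrk` (`rank₃ Cl(K₁) = rank₃ Cl(K) = 1`, kit j313536). A SECOND road beside `missingUpperBoundAt_g486720db1_3`. Per row; nothing booked; BSD is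
not proved by this. [cite: Kato2004Asterisque, Thm. 14.5 (3) (p. 236), Thm. 12.5 (3) (p. 222)] [cite: Fukuda1994, Thm. 1 (2), p. 264]
[cite: CoatesSujatha2005, Thm. 3.4 (§3)] [cite: Serre1972, §2.4 Prop. 15, §5.2 (iv)] [cite: Cremona2006, Table 1 (Cremona label 486720db1)]
hF2-FREE re-issue of `missingUpperBoundAt_g486720db1_3_fukuda` (Fukuda 1994 Thm. 1 (2) is the tree theorem
`fukuda1994_thm1_classGroupPRank_const_of_succ_eq_holds`). -/
theorem missingUpperBoundAt_g486720db1_3_fukudaF2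
    (hKatoA : Kato2004.rankZero_padicValNat_sha_add_padicValNat_tamagawa_le_of_additive_potGood_of_irreducible_of_fineSelmerDual_fg)
    (hGZK : rank_eq_analyticRank_of_analyticRank_le_one) (hmod : hasEntireLFunction_rat)
    (hCS : CoatesSujatha2005.thm34_fineSelmerDual_moduleFinite_of_classicalMuVanishes_divisionField)
    (hI : iwasawa1959_classNumberPExp_growth) (hFW : ferreroWashington1979_classicalMuVanishes)
    {W : WeierstrassCurve ℚ} [W.IsElliptic] [W.IsGloballyMinimal] (hWeq : W = (⟨0, 0, 0, 5813262, (-5593900338)⟩ : WeierstrassCurve ℚ))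
    (hr : W.analyticRank = 0) {c : absoluteGaloisGroup ℚ} (hc : IsComplexConjugation (Rat.castHom ℝ) c)
    (hrk : ∀ κE : ZpExtension ↥(fixedField (Subgroup.zpowers (absRestrictNormalHom (W.divisionField 3) c))) 3,
      κE.IsCyclotomic → classGroupPRank κE (0 + 1) = classGroupPRank κE 0) :
    MissingUpperBoundAt W 3 := by
  apply missingUpperBoundAt_g486720db1_3_fukuda <;>
    first
    | exact Literature.NumberTheory.IwasawaTheory.fukuda1994_thm1_classGroupPRank_const_of_succ_eq_holds
    | assumption

/-- **RECORD — statement (A) at `(E, 3)` for `E = 486720dc1`** by Fukuda Thm. 1 (2) (`3`-ranks) on `K = ℚ(P)` at layers `(0, 1)`: door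
`CartanMuRoadFukudaDoorsTprime.conjA_three_of_hasModPImageEqNonsplitCartanNormalizer_of_realRankSuccEqAt'` (`hram`-free). KERNEL: `E[3]`
irreducible (`irr_g486720dc1_3`), image `= C_ns⁺(3)` (`hasModPImageEqNonsplitCartanNormalizer_g486720dc1_3`). DISPLAYED: `hCS hI hFW hF2`; `c`; `hrk`
(`rank₃ Cl(K₁) = rank₃ Cl(K) = 1`, kit j313536). CONDITIONAL; (A) asserted for
no curve. [cite: Fukuda1994, Thm. 1 (2), p. 264] [cite: CoatesSujatha2005, Thm. 3.4 (§3)] [cite: Serre1972, §2.4 Prop. 15, §5.2 (iv)]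
[cite: Cremona2006, Table 1 (Cremona label 486720dc1)]
hF2-FREE re-issue of `conjA_g486720dc1_3_fukuda` (Fukuda 1994 Thm. 1 (2) is the tree theorem
`fukuda1994_thm1_classGroupPRank_const_of_succ_eq_holds`). -/
theorem conjA_g486720dc1_3_fukudaF2
    (hCS : CoatesSujatha2005.thm34_fineSelmerDual_moduleFinite_of_classicalMuVanishes_divisionField)
    (hI : iwasawa1959_classNumberPExp_growth) (hFW : ferreroWashington1979_classicalMuVanishes)
    {W : WeierstrassCurve ℚ} [W.IsElliptic] (hWeq : W = (⟨0, 0, 0, 3822, (-94302)⟩ : WeierstrassCurve ℚ))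
    {c : absoluteGaloisGroup ℚ} (hc : IsComplexConjugation (Rat.castHom ℝ) c)
    (hrk : ∀ κE : ZpExtension ↥(fixedField (Subgroup.zpowers (absRestrictNormalHom (W.divisionField 3) c))) 3,
      κE.IsCyclotomic → classGroupPRank κE (0 + 1) = classGroupPRank κE 0)
    (κ : ZpExtension ℚ 3) (hκ : κ.IsCyclotomic) :
    ∃ (γ : absoluteGaloisGroup ℚ) (Df : W.FineSelmerDualData κ γ),
      Module.Finite ℤ_[3] (RestrictScalars ℤ_[3] (IwasawaAlgebra 3) Df.X) := by
  apply conjA_g486720dc1_3_fukuda <;>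
    first
    | exact Literature.NumberTheory.IwasawaTheory.fukuda1994_thm1_classGroupPRank_const_of_succ_eq_holds
    | assumption

/-- **RECORD — UPPER half `ord₃ #Ш(E) ≤ ord₃ #Ш(E)_an` for `E = 486720dc1` at `p = 3`** (U₀-ns row of node 19202 / item 19982) by Fukuda Thm. 1 (2) (`3`-ranks) on
`K = ℚ(P)` at layers `(0, 1)`: door `CartanMuRoadFukudaDoorsTprime.missingUpperBoundAt_three_tame_of_hasModPImageEqNonsplitCartanNormalizer_of_realRankSuccEqAt'`
(`hram`-free). KERNEL: `irr_g486720dc1_3`, `addv_g486720dc1_3`, `subTprime_g486720dc1_3` (reused), `hasModPImageEqNonsplitCartanNormalizer_g486720dc1_3`. DISPLAYED: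
`hKatoA hGZK hmod hCS hI hFW hF2`; Cremona's `r_an = 0` (`hr`); `c`; `hrk` (`rank₃ Cl(K₁) = rank₃ Cl(K) = 1`, kit j313536). A SECOND road beside `missingUpperBoundAt_g486720dc1_3`. Per row; nothing booked; BSD is
not proved by this. [cite: Kato2004Asterisque, Thm. 14.5 (3) (p. 236), Thm. 12.5 (3) (p. 222)] [cite: Fukuda1994, Thm. 1 (2), p. 264]
[cite: CoatesSujatha2005, Thm. 3.4 (§3)] [cite: Serre1972, §2.4 Prop. 15, §5.2 (iv)] [cite: Cremona2006, Table 1 (Cremona label 486720dc1)]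
hF2-FREE re-issue of `missingUpperBoundAt_g486720dc1_3_fukuda` (Fukuda 1994 Thm. 1 (2) is the tree theorem
`fukuda1994_thm1_classGroupPRank_const_of_succ_eq_holds`). -/
theorem missingUpperBoundAt_g486720dc1_3_fukudaF2
    (hKatoA : Kato2004.rankZero_padicValNat_sha_add_padicValNat_tamagawa_le_of_additive_potGood_of_irreducible_of_fineSelmerDual_fg)
    (hGZK : rank_eq_analyticRank_of_analyticRank_le_one) (hmod : hasEntireLFunction_rat)
    (hCS : CoatesSujatha2005.thm34_fineSelmerDual_moduleFinite_of_classicalMuVanishes_divisionField)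
    (hI : iwasawa1959_classNumberPExp_growth) (hFW : ferreroWashington1979_classicalMuVanishes)
    {W : WeierstrassCurve ℚ} [W.IsElliptic] [W.IsGloballyMinimal] (hWeq : W = (⟨0, 0, 0, 3822, (-94302)⟩ : WeierstrassCurve ℚ))
    (hr : W.analyticRank = 0) {c : absoluteGaloisGroup ℚ} (hc : IsComplexConjugation (Rat.castHom ℝ) c)
    (hrk : ∀ κE : ZpExtension ↥(fixedField (Subgroup.zpowers (absRestrictNormalHom (W.divisionField 3) c))) 3,
      κE.IsCyclotomic → classGroupPRank κE (0 + 1) = classGroupPRank κE 0) :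
    MissingUpperBoundAt W 3 := by
  apply missingUpperBoundAt_g486720dc1_3_fukuda <;>
    first
    | exact Literature.NumberTheory.IwasawaTheory.fukuda1994_thm1_classGroupPRank_const_of_succ_eq_holds
    | assumption

end Summit.BirchSwinnertonDyer.BirchSwinnertonDyer.Theorems.TameUpperUnitTwistRecords

end
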